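import Mathlib
import Summits.Ventures.PercRepro2.Defs
import Summits.Ventures.PercRepro2.CoinKStarLattice

/-!
# The TILT LEMMA (blind cell PercRepro2, night-2 g5; proofs/NIGHT2-DARC.md §26.3 (F5))

For a log-supermodular nonnegative weight `μ` on the subsets of `Vs`, increasing nonnegative data
`x, y`, write `pw μ = Σ μ`, `pm μ x = Σ μ x` and the FKG bracket
`pk μ x y = pw μ · pm μ (xy) − pm μ x · pm μ y` (`= pw μ` times the unnormalised covariance).
Tilting `μ` by a DECREASING PRODUCT `L ↦ ∏_{j ∈ T ∩ L} q_j` (`0 ≤ q_j ≤ 1`) lowers the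
unnormalised covariance: `pk (μ·π) x y · pw μ ≤ pk μ x y · pw (μ·π)` (`tilt_prod`).
One coordinate at a time (`tilt_single`): splitting the powerset into the layers `{i ∉ L}` and
`{i ∈ L}` with masses `S₀, S₁`, sums `X, Y, Z` of `μx, μy, μxy` and brackets `K₀, K₁ ≥ 0`
(FKG on each layer), and `D = X₁S₀ − X₀S₁ ≥ 0`, `D' = Y₁S₀ − Y₀S₁ ≥ 0` (the upper layer
dominates the lower one in the Holley sense), the cleared difference is
`S₁·(RHS − LHS) = (1 − q)·(S₀²K₁ + DD' + S₁K₁((1 + q)S₀ + qS₁)) ≥ 0` — the cleared form of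
`U(μ^{(q)}) = U₀ + qU₁ + qS₀S₁/(S₀ + qS₁)·Δx̄Δȳ`.
-/

namespace Summit.Ventures.PercRepro2.Coin

section Tilt

open Classical

variable {V : Type*} [Fintype V] [DecidableEq V] {R : Type*} [Field R] [LinearOrder R]
  [IsStrictOrderedRing R]

/-- Total mass over the powerset. -/
def pw (Vs : Finset V) (μ : Finset V → R) : R := ∑ L ∈ Vs.powerset, μ L

/-- First moment over the powerset. -/
def pm (Vs : Finset V) (μ x : Finset V → R) : R := ∑ L ∈ Vs.powerset, μ L * x L

/-- The FKG bracket `(Σ μ)(Σ μ x y) − (Σ μ x)(Σ μ y)`. -/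
def pk (Vs : Finset V) (μ x y : Finset V → R) : R :=
  pw Vs μ * pm Vs μ (fun L => x L * y L) - pm Vs μ x * pm Vs μ y

/-- The single-coordinate tilt. -/
def tilt (i : V) (q : R) (μ : Finset V → R) : Finset V → R :=
  fun L => μ L * (if i ∈ L then q else 1)

omit [Fintype V] [LinearOrder R] [IsStrictOrderedRing R] in
/-- The tilt does nothing on the lower layer `{i ∉ L}`. -/
lemma tilt_of_notMem {i : V} {q : R} {μ : Finset V → R} {L : Finset V} (h : i ∉ L) :
    tilt i q μ L = μ L := by simp [tilt, h]

omit [Fintype V] [LinearOrder R] [IsStrictOrderedRing R] in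
/-- The tilt multiplies by `q` on the upper layer `{i ∈ L}`. -/
lemma tilt_of_mem {i : V} {q : R} {μ : Finset V → R} {L : Finset V} (h : i ∈ L) :
    tilt i q μ L = μ L * q := by simp [tilt, h]

omit [Fintype V] [LinearOrder R] [IsStrictOrderedRing R] in
/-- Splitting a sum over the powerset of `Vs ∋ i` into the two layers `{i ∉ L}`, `{i ∈ L}`. -/
lemma sum_powerset_split {Vs : Finset V} {i : V} (hi : i ∈ Vs) (g : Finset V → R) :
    ∑ L ∈ Vs.powerset, g L =
      ∑ M ∈ (Vs.erase i).powerset, g M + ∑ M ∈ (Vs.erase i).powerset, g (insert i M) := by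
  have hV : Vs = insert i (Vs.erase i) := (Finset.insert_erase hi).symm
  conv_lhs => rw [hV, Finset.powerset_insert]
  rw [Finset.sum_union]
  · congr 1
    rw [Finset.sum_image]
    intro M hM M' hM' h
    have hiM : i ∉ M := fun h' => (Finset.mem_erase.mp (Finset.mem_powerset.mp hM h')).1 rfl
    have hiM' : i ∉ M' := fun h' => (Finset.mem_erase.mp (Finset.mem_powerset.mp hM' h')).1 rfl
    rw [← Finset.erase_insert hiM, ← Finset.erase_insert hiM', h]
  · rw [Finset.disjoint_left]
    intro M hM hM'
    obtain ⟨M', _, rfl⟩ := Finset.mem_image.mp hM'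
    exact (Finset.mem_erase.mp (Finset.mem_powerset.mp hM (Finset.mem_insert_self i M'))).1 rfl

omit [Fintype V] [Field R] [LinearOrder R] [IsStrictOrderedRing R] in
/-- A subset of `Vs.erase i` does not contain `i`. -/
lemma notMem_of_mem_powerset_erase {Vs M : Finset V} {i : V}
    (hM : M ∈ (Vs.erase i).powerset) : i ∉ M :=
  fun h => (Finset.mem_erase.mp (Finset.mem_powerset.mp hM h)).1 rfl

omit [Fintype V] [Field R] [LinearOrder R] [IsStrictOrderedRing R] in
/-- A subset of `Vs.erase i` is a subset of `Vs`. -/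
lemma subset_of_mem_powerset_erase {Vs M : Finset V} {i : V}
    (hM : M ∈ (Vs.erase i).powerset) : M ⊆ Vs :=
  (Finset.mem_powerset.mp hM).trans (Finset.erase_subset i Vs)

omit [Fintype V] [Field R] [LinearOrder R] [IsStrictOrderedRing R] in
/-- Adding `i ∈ Vs` to a subset of `Vs.erase i` stays inside `Vs`. -/
lemma insert_subset_of_mem_powerset_erase {Vs M : Finset V} {i : V} (hi : i ∈ Vs)
    (hM : M ∈ (Vs.erase i).powerset) : insert i M ⊆ Vs :=
  Finset.insert_subset hi (subset_of_mem_powerset_erase hM)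

omit [Fintype V] [Field R] [LinearOrder R] [IsStrictOrderedRing R] in
/-- `insert i M ∩ insert i M' = insert i (M ∩ M')`. -/
lemma insert_inter_insert' (i : V) (M M' : Finset V) :
    insert i M ∩ insert i M' = insert i (M ∩ M') := by
  ext x; simp only [Finset.mem_inter, Finset.mem_insert]; tauto

omit [Fintype V] [Field R] [LinearOrder R] [IsStrictOrderedRing R] in
/-- `insert i M ∪ insert i M' = insert i (M ∪ M')`. -/
lemma insert_union_insert' (i : V) (M M' : Finset V) :
    insert i M ∪ insert i M' = insert i (M ∪ M') := by
  ext x; simp only [Finset.mem_union, Finset.mem_insert]; tauto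

omit [Fintype V] [Field R] [LinearOrder R] [IsStrictOrderedRing R] in
/-- `M ∩ insert i M' = M ∩ M'` when `i ∉ M`. -/
lemma inter_insert_of_notMem' {i : V} {M : Finset V} (h : i ∉ M) (M' : Finset V) :
    M ∩ insert i M' = M ∩ M' := by
  ext x; simp only [Finset.mem_inter, Finset.mem_insert]
  constructor
  · rintro ⟨hx, hx'⟩
    rcases hx' with rfl | hx'
    · exact absurd hx h
    · exact ⟨hx, hx'⟩
  · rintro ⟨hx, hx'⟩; exact ⟨hx, Or.inr hx'⟩

omit [Fintype V] [Field R] [LinearOrder R] [IsStrictOrderedRing R] in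
/-- `M ∪ insert i M' = insert i (M ∪ M')`. -/
lemma union_insert' (i : V) (M M' : Finset V) : M ∪ insert i M' = insert i (M ∪ M') := by
  ext x; simp only [Finset.mem_union, Finset.mem_insert]; tauto

omit [Fintype V] [DecidableEq V] [LinearOrder R] [IsStrictOrderedRing R] in
/-- The FKG bracket of a weight vanishing on the powerset is `0`. -/
lemma pk_eq_zero_of_zero {Vs : Finset V} {μ : Finset V → R} (h : ∀ L ⊆ Vs, μ L = 0)
    (x y : Finset V → R) : pk Vs μ x y = 0 := by
  have hw : pw Vs μ = 0 := Finset.sum_eq_zero fun L hL => h L (Finset.mem_powerset.mp hL)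
  have hm : ∀ z : Finset V → R, pm Vs μ z = 0 := fun z =>
    Finset.sum_eq_zero fun L hL => by rw [h L (Finset.mem_powerset.mp hL), zero_mul]
  simp [pk, hw, hm]

/-- **The single-coordinate tilt lemma**: tilting by `q ∈ [0, 1]` on the layer `{i ∈ L}` lowers
the unnormalised covariance, in the cleared form `pk (tilt) · pw μ ≤ pk μ · pw (tilt)`. -/
theorem tilt_single (Vs : Finset V) (μ x y : Finset V → R) {i : V} (hi : i ∈ Vs) {q : R}
    (hq0 : 0 ≤ q) (hq1 : q ≤ 1) (hμ0 : ∀ L ⊆ Vs, 0 ≤ μ L)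
    (hμ : ∀ L L', L ⊆ Vs → L' ⊆ Vs → μ L * μ L' ≤ μ (L ∩ L') * μ (L ∪ L'))
    (hx0 : ∀ L ⊆ Vs, 0 ≤ x L) (hy0 : ∀ L ⊆ Vs, 0 ≤ y L)
    (hx : ∀ L L', L ⊆ L' → L' ⊆ Vs → x L ≤ x L')
    (hy : ∀ L L', L ⊆ L' → L' ⊆ Vs → y L ≤ y L') :
    pk Vs (tilt i q μ) x y * pw Vs μ ≤ pk Vs μ x y * pw Vs (tilt i q μ) := by
  set Vs' := Vs.erase i with hVs'
  -- the layer sums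
  set S₀ := ∑ M ∈ Vs'.powerset, μ M with hS₀
  set S₁ := ∑ M ∈ Vs'.powerset, μ (insert i M) with hS₁
  set X₀ := ∑ M ∈ Vs'.powerset, μ M * x M with hX₀
  set X₁ := ∑ M ∈ Vs'.powerset, μ (insert i M) * x (insert i M) with hX₁
  set Y₀ := ∑ M ∈ Vs'.powerset, μ M * y M with hY₀
  set Y₁ := ∑ M ∈ Vs'.powerset, μ (insert i M) * y (insert i M) with hY₁
  set Z₀ := ∑ M ∈ Vs'.powerset, μ M * (x M * y M) with hZ₀
  set Z₁ := ∑ M ∈ Vs'.powerset, μ (insert i M) * (x (insert i M) * y (insert i M)) with hZ₁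
  -- the eight sums in terms of the layers
  have e1 : pw Vs μ = S₀ + S₁ := sum_powerset_split hi μ
  have e2 : pw Vs (tilt i q μ) = S₀ + q * S₁ := by
    rw [pw, sum_powerset_split hi, hS₀, hS₁, Finset.mul_sum]
    congr 1
    · exact Finset.sum_congr rfl fun M hM => tilt_of_notMem (notMem_of_mem_powerset_erase hM)
    · exact Finset.sum_congr rfl fun M _ => by
        rw [tilt_of_mem (Finset.mem_insert_self i M), mul_comm]
  have e3 : ∀ z : Finset V → R, pm Vs μ z =
      (∑ M ∈ Vs'.powerset, μ M * z M) + ∑ M ∈ Vs'.powerset, μ (insert i M) * z (insert i M) :=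
    fun z => sum_powerset_split hi _
  have e4 : ∀ z : Finset V → R, pm Vs (tilt i q μ) z =
      (∑ M ∈ Vs'.powerset, μ M * z M) +
        q * ∑ M ∈ Vs'.powerset, μ (insert i M) * z (insert i M) := by
    intro z
    rw [pm, sum_powerset_split hi, Finset.mul_sum]
    congr 1
    · exact Finset.sum_congr rfl fun M hM => by
        rw [tilt_of_notMem (notMem_of_mem_powerset_erase hM)]
    · exact Finset.sum_congr rfl fun M _ => by
        rw [tilt_of_mem (Finset.mem_insert_self i M)]; ring
  -- FKG on the two layers
  have hK₀ : 0 ≤ S₀ * Z₀ - X₀ * Y₀ := by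
    have h := fkg_powerset Vs' μ x y (fun L hL => hμ0 L (hL.trans (Finset.erase_subset i Vs)))
      (fun L hL => hx0 L (hL.trans (Finset.erase_subset i Vs)))
      (fun L hL => hy0 L (hL.trans (Finset.erase_subset i Vs)))
      (fun L L' h h' => hx L L' h (h'.trans (Finset.erase_subset i Vs)))
      (fun L L' h h' => hy L L' h (h'.trans (Finset.erase_subset i Vs)))
      (fun L L' h h' => hμ L L' (h.trans (Finset.erase_subset i Vs))
        (h'.trans (Finset.erase_subset i Vs)))
    rw [sub_nonneg]; exact h
  have hK₁ : 0 ≤ S₁ * Z₁ - X₁ * Y₁ := by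
    have h := fkg_powerset Vs' (fun M => μ (insert i M)) (fun M => x (insert i M))
      (fun M => y (insert i M))
      (fun L hL => hμ0 _ (Finset.insert_subset hi (hL.trans (Finset.erase_subset i Vs))))
      (fun L hL => hx0 _ (Finset.insert_subset hi (hL.trans (Finset.erase_subset i Vs))))
      (fun L hL => hy0 _ (Finset.insert_subset hi (hL.trans (Finset.erase_subset i Vs))))
      (fun L L' h h' => hx _ _ (Finset.insert_subset_insert i h)
        (Finset.insert_subset hi (h'.trans (Finset.erase_subset i Vs))))
      (fun L L' h h' => hy _ _ (Finset.insert_subset_insert i h)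
        (Finset.insert_subset hi (h'.trans (Finset.erase_subset i Vs))))
      (fun L L' h h' => by
        have := hμ (insert i L) (insert i L')
          (Finset.insert_subset hi (h.trans (Finset.erase_subset i Vs)))
          (Finset.insert_subset hi (h'.trans (Finset.erase_subset i Vs)))
        rwa [insert_inter_insert', insert_union_insert'] at this)
    rw [sub_nonneg]; exact h
  -- the upper layer dominates the lower one
  have hD : ∀ z : Finset V → R, (∀ L ⊆ Vs, 0 ≤ z L) → (∀ L L', L ⊆ L' → L' ⊆ Vs → z L ≤ z L') →
      0 ≤ (∑ M ∈ Vs'.powerset, μ (insert i M) * z (insert i M)) * S₀ -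
        (∑ M ∈ Vs'.powerset, μ M * z M) * S₁ := by
    intro z hz0 hz
    have h := holley_powerset Vs' μ (fun M => μ (insert i M)) z
      (fun L hL => hμ0 L (hL.trans (Finset.erase_subset i Vs)))
      (fun L hL => hμ0 _ (Finset.insert_subset hi (hL.trans (Finset.erase_subset i Vs))))
      (fun L hL => hz0 L (hL.trans (Finset.erase_subset i Vs)))
      (fun L L' h h' => hz L L' h (h'.trans (Finset.erase_subset i Vs)))
      (fun L L' h h' => by
        have hiL : i ∉ L := fun hiL => (Finset.mem_erase.mp (h hiL)).1 rfl
        have := hμ L (insert i L') (h.trans (Finset.erase_subset i Vs))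
          (Finset.insert_subset hi (h'.trans (Finset.erase_subset i Vs)))
        rwa [inter_insert_of_notMem' hiL, union_insert'] at this)
    have h2 : (∑ M ∈ Vs'.powerset, μ M) * ∑ M ∈ Vs'.powerset, μ (insert i M) * z M ≤
        (∑ M ∈ Vs'.powerset, μ M) * ∑ M ∈ Vs'.powerset, μ (insert i M) * z (insert i M) := by
      refine mul_le_mul_of_nonneg_left (Finset.sum_le_sum fun M hM => ?_)
        (Finset.sum_nonneg fun M hM => hμ0 M (subset_of_mem_powerset_erase hM))
      exact mul_le_mul_of_nonneg_left
        (hz M (insert i M) (Finset.subset_insert i M) (insert_subset_of_mem_powerset_erase hi hM))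
        (hμ0 _ (insert_subset_of_mem_powerset_erase hi hM))
    rw [sub_nonneg]
    calc (∑ M ∈ Vs'.powerset, μ M * z M) * S₁
        = (∑ M ∈ Vs'.powerset, μ M * z M) * ∑ M ∈ Vs'.powerset, μ (insert i M) := rfl
      _ ≤ (∑ M ∈ Vs'.powerset, μ M) * ∑ M ∈ Vs'.powerset, μ (insert i M) * z (insert i M) :=
        h.trans h2
      _ = (∑ M ∈ Vs'.powerset, μ (insert i M) * z (insert i M)) * S₀ := by rw [mul_comm]
  have hDx : 0 ≤ X₁ * S₀ - X₀ * S₁ := hD x hx0 hx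
  have hDy : 0 ≤ Y₁ * S₀ - Y₀ * S₁ := hD y hy0 hy
  have hS₀ : 0 ≤ S₀ := Finset.sum_nonneg fun M hM => hμ0 M (subset_of_mem_powerset_erase hM)
  have hS₁ : 0 ≤ S₁ :=
    Finset.sum_nonneg fun M hM => hμ0 _ (insert_subset_of_mem_powerset_erase hi hM)
  -- the goal in the layer variables
  have eL : pk Vs (tilt i q μ) x y * pw Vs μ =
      ((S₀ + q * S₁) * (Z₀ + q * Z₁) - (X₀ + q * X₁) * (Y₀ + q * Y₁)) * (S₀ + S₁) := by
    rw [pk, e2, e4, e4, e4, e1]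
  have eR : pk Vs μ x y * pw Vs (tilt i q μ) =
      ((S₀ + S₁) * (Z₀ + Z₁) - (X₀ + X₁) * (Y₀ + Y₁)) * (S₀ + q * S₁) := by
    rw [pk, e1, e3, e3, e3, e2]
  rw [eL, eR]
  rcases hS₁.lt_or_eq with hS₁pos | hS₁zero
  · -- the cleared identity
    have key : S₁ * ((((S₀ + S₁) * (Z₀ + Z₁) - (X₀ + X₁) * (Y₀ + Y₁)) * (S₀ + q * S₁)) -
        (((S₀ + q * S₁) * (Z₀ + q * Z₁) - (X₀ + q * X₁) * (Y₀ + q * Y₁)) * (S₀ + S₁))) =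
        (1 - q) * (S₀ ^ 2 * (S₁ * Z₁ - X₁ * Y₁) + (X₁ * S₀ - X₀ * S₁) * (Y₁ * S₀ - Y₀ * S₁) +
          S₁ * (S₁ * Z₁ - X₁ * Y₁) * ((1 + q) * S₀ + q * S₁)) := by ring
    have hnn : 0 ≤ (1 - q) * (S₀ ^ 2 * (S₁ * Z₁ - X₁ * Y₁) +
        (X₁ * S₀ - X₀ * S₁) * (Y₁ * S₀ - Y₀ * S₁) +
          S₁ * (S₁ * Z₁ - X₁ * Y₁) * ((1 + q) * S₀ + q * S₁)) := by
      refine mul_nonneg (by linarith) (add_nonneg (add_nonneg (mul_nonneg (sq_nonneg _) hK₁)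
        (mul_nonneg hDx hDy)) (mul_nonneg (mul_nonneg hS₁ hK₁) ?_))
      exact add_nonneg (mul_nonneg (by linarith) hS₀) (mul_nonneg hq0 hS₁)
    rw [← key] at hnn
    have h2 := (mul_nonneg_iff_of_pos_left hS₁pos).mp hnn
    linarith
  · -- the upper layer is empty: nothing changes
    have hzero : ∀ M ∈ Vs'.powerset, μ (insert i M) = 0 := by
      have := (Finset.sum_eq_zero_iff_of_nonneg fun M hM =>
        hμ0 _ (insert_subset_of_mem_powerset_erase hi hM)).mp hS₁zero.symm
      exact this
    have hX₁ : X₁ = 0 := Finset.sum_eq_zero fun M hM => by rw [hzero M hM, zero_mul]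
    have hY₁ : Y₁ = 0 := Finset.sum_eq_zero fun M hM => by rw [hzero M hM, zero_mul]
    have hZ₁ : Z₁ = 0 := Finset.sum_eq_zero fun M hM => by rw [hzero M hM, zero_mul]
    rw [← hS₁zero, hX₁, hY₁, hZ₁]
    ring_nf
    exact le_rfl

/-- The product tilt by `q` on the coordinates of `T`. -/
def tiltProd (T : Finset V) (q : V → R) (μ : Finset V → R) : Finset V → R :=
  fun L => μ L * ∏ j ∈ T, (if j ∈ L then q j else 1)

omit [Fintype V] [LinearOrder R] [IsStrictOrderedRing R] in
/-- The product tilt on no coordinates is the identity. -/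
lemma tiltProd_empty (q : V → R) (μ : Finset V → R) : tiltProd ∅ q μ = μ := by
  funext L; simp [tiltProd]

omit [Fintype V] [LinearOrder R] [IsStrictOrderedRing R] in
/-- The product tilt on `insert j T` is the single tilt at `j` of the product tilt on `T`. -/
lemma tiltProd_insert {T : Finset V} {j : V} (hj : j ∉ T) (q : V → R) (μ : Finset V → R) :
    tiltProd (insert j T) q μ = tilt j (q j) (tiltProd T q μ) := by
  funext L
  simp only [tiltProd, tilt, Finset.prod_insert hj]
  ring

omit [Fintype V] in
/-- The product tilt of a nonnegative weight by nonnegative factors is nonnegative. -/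
lemma tiltProd_nonneg {T : Finset V} {q : V → R} {μ : Finset V → R} (hq0 : ∀ j ∈ T, 0 ≤ q j)
    {Vs : Finset V} (hμ0 : ∀ L ⊆ Vs, 0 ≤ μ L) : ∀ L ⊆ Vs, 0 ≤ tiltProd T q μ L := by
  intro L hL
  refine mul_nonneg (hμ0 L hL) (Finset.prod_nonneg fun j hj => ?_)
  split_ifs
  · exact hq0 j hj
  · exact zero_le_one

omit [Fintype V] [LinearOrder R] [IsStrictOrderedRing R] in
/-- The product tilt is log-modular. -/
lemma tiltProd_factor_mul (T : Finset V) (q : V → R) (L L' : Finset V) :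
    (∏ j ∈ T, (if j ∈ L then q j else 1)) * ∏ j ∈ T, (if j ∈ L' then q j else 1) =
      (∏ j ∈ T, (if j ∈ L ∩ L' then q j else 1)) * ∏ j ∈ T, (if j ∈ L ∪ L' then q j else 1) := by
  rw [← Finset.prod_mul_distrib, ← Finset.prod_mul_distrib]
  refine Finset.prod_congr rfl fun j _ => ?_
  by_cases h1 : j ∈ L <;> by_cases h2 : j ∈ L' <;> simp [h1, h2]

omit [Fintype V] in
/-- The product tilt preserves log-supermodularity. -/
lemma tiltProd_lsm {T : Finset V} {q : V → R} {μ : Finset V → R} (hq0 : ∀ j ∈ T, 0 ≤ q j)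
    {Vs : Finset V}
    (hμ : ∀ L L', L ⊆ Vs → L' ⊆ Vs → μ L * μ L' ≤ μ (L ∩ L') * μ (L ∪ L')) :
    ∀ L L', L ⊆ Vs → L' ⊆ Vs →
      tiltProd T q μ L * tiltProd T q μ L' ≤ tiltProd T q μ (L ∩ L') * tiltProd T q μ (L ∪ L') := by
  intro L L' hL hL'
  have hf : 0 ≤ (∏ j ∈ T, (if j ∈ L then q j else 1)) * ∏ j ∈ T, (if j ∈ L' then q j else 1) := by
    refine mul_nonneg (Finset.prod_nonneg fun j hj => ?_) (Finset.prod_nonneg fun j hj => ?_) <;>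
      split_ifs <;> first | exact hq0 j hj | exact zero_le_one
  calc tiltProd T q μ L * tiltProd T q μ L'
      = (μ L * μ L') * ((∏ j ∈ T, (if j ∈ L then q j else 1)) *
          ∏ j ∈ T, (if j ∈ L' then q j else 1)) := by simp only [tiltProd]; ring
    _ ≤ (μ (L ∩ L') * μ (L ∪ L')) * ((∏ j ∈ T, (if j ∈ L then q j else 1)) *
          ∏ j ∈ T, (if j ∈ L' then q j else 1)) :=
        mul_le_mul_of_nonneg_right (hμ L L' hL hL') hf
    _ = tiltProd T q μ (L ∩ L') * tiltProd T q μ (L ∪ L') := by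
        rw [tiltProd_factor_mul]; simp only [tiltProd]; ring

/-- **The product tilt lemma**: a decreasing product tilt (`0 ≤ q_j ≤ 1`) on any set of
coordinates `T ⊆ Vs` lowers the unnormalised covariance of increasing data under a
log-supermodular weight: `pk (μ·π) · pw μ ≤ pk μ · pw (μ·π)`. -/
theorem tilt_prod (Vs : Finset V) (μ x y : Finset V → R) (q : V → R)
    (hq0 : ∀ j ∈ Vs, 0 ≤ q j) (hq1 : ∀ j ∈ Vs, q j ≤ 1) (hμ0 : ∀ L ⊆ Vs, 0 ≤ μ L)
    (hμ : ∀ L L', L ⊆ Vs → L' ⊆ Vs → μ L * μ L' ≤ μ (L ∩ L') * μ (L ∪ L'))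
    (hx0 : ∀ L ⊆ Vs, 0 ≤ x L) (hy0 : ∀ L ⊆ Vs, 0 ≤ y L)
    (hx : ∀ L L', L ⊆ L' → L' ⊆ Vs → x L ≤ x L')
    (hy : ∀ L L', L ⊆ L' → L' ⊆ Vs → y L ≤ y L') :
    ∀ T : Finset V, T ⊆ Vs →
      pk Vs (tiltProd T q μ) x y * pw Vs μ ≤ pk Vs μ x y * pw Vs (tiltProd T q μ) := by
  intro T
  induction T using Finset.induction_on with
  | empty => intro _; rw [tiltProd_empty]
  | insert j T hj ih =>
    intro hT
    have hTV : T ⊆ Vs := (Finset.subset_insert j T).trans hT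
    have hjV : j ∈ Vs := hT (Finset.mem_insert_self j T)
    have ih' := ih hTV
    set μ' := tiltProd T q μ with hμ'
    have hμ'0 : ∀ L ⊆ Vs, 0 ≤ μ' L := tiltProd_nonneg (fun j hj => hq0 j (hTV hj)) hμ0
    have hμ'lsm := tiltProd_lsm (T := T) (q := q) (fun j hj => hq0 j (hTV hj)) hμ
    have hstep := tilt_single Vs μ' x y hjV (hq0 j hjV) (hq1 j hjV) hμ'0 hμ'lsm hx0 hy0 hx hy
    rw [tiltProd_insert hj, ← hμ']
    have hw0 : 0 ≤ pw Vs μ := Finset.sum_nonneg fun L hL => hμ0 L (Finset.mem_powerset.mp hL)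
    have hw'0 : 0 ≤ pw Vs μ' := Finset.sum_nonneg fun L hL => hμ'0 L (Finset.mem_powerset.mp hL)
    have hw''0 : 0 ≤ pw Vs (tilt j (q j) μ') := Finset.sum_nonneg fun L hL => by
      simp only [tilt]
      refine mul_nonneg (hμ'0 L (Finset.mem_powerset.mp hL)) ?_
      split_ifs
      · exact hq0 j hjV
      · exact zero_le_one
    rcases hw'0.lt_or_eq with hpos | hzero
    · -- chain the two inequalities and cancel `pw μ'`
      have h1 : pk Vs (tilt j (q j) μ') x y * pw Vs μ' * pw Vs μ ≤
          pk Vs μ' x y * pw Vs (tilt j (q j) μ') * pw Vs μ :=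
        mul_le_mul_of_nonneg_right hstep hw0
      have h2 : pk Vs μ' x y * pw Vs μ * pw Vs (tilt j (q j) μ') ≤
          pk Vs μ x y * pw Vs μ' * pw Vs (tilt j (q j) μ') :=
        mul_le_mul_of_nonneg_right ih' hw''0
      have h3 : pw Vs μ' * (pk Vs (tilt j (q j) μ') x y * pw Vs μ) ≤
          pw Vs μ' * (pk Vs μ x y * pw Vs (tilt j (q j) μ')) := by
        calc pw Vs μ' * (pk Vs (tilt j (q j) μ') x y * pw Vs μ)
            = pk Vs (tilt j (q j) μ') x y * pw Vs μ' * pw Vs μ := by ring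
          _ ≤ pk Vs μ' x y * pw Vs (tilt j (q j) μ') * pw Vs μ := h1
          _ = pk Vs μ' x y * pw Vs μ * pw Vs (tilt j (q j) μ') := by ring
          _ ≤ pk Vs μ x y * pw Vs μ' * pw Vs (tilt j (q j) μ') := h2
          _ = pw Vs μ' * (pk Vs μ x y * pw Vs (tilt j (q j) μ')) := by ring
      exact le_of_mul_le_mul_left h3 hpos
    · -- `μ'` vanishes on the powerset, hence so does its tilt
      have hz : ∀ L ⊆ Vs, μ' L = 0 := by
        have := (Finset.sum_eq_zero_iff_of_nonneg fun L hL =>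
          hμ'0 L (Finset.mem_powerset.mp hL)).mp hzero.symm
        exact fun L hL => this L (Finset.mem_powerset.mpr hL)
      have hz' : ∀ L ⊆ Vs, tilt j (q j) μ' L = 0 := fun L hL => by
        simp [tilt, hz L hL]
      have hpk : pk Vs (tilt j (q j) μ') x y = 0 := pk_eq_zero_of_zero hz' x y
      have hpw : pw Vs (tilt j (q j) μ') = 0 :=
        Finset.sum_eq_zero fun L hL => hz' L (Finset.mem_powerset.mp hL)
      rw [hpk, hpw, zero_mul, mul_zero]

end Tilt

end Summit.Ventures.PercRepro2.Coin
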